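import Summits.CriticalPhenomena.CardyFormulaZ2.Theorems.CardyMagicRigidityNestingRigidityNeckHookStar
import Summits.CriticalPhenomena.CardyFormulaZ2.Theorems.CardyMagicRigidityNestingRigidityNeckCoarseStructure
import HarnessLib

/-!
# The easy half of the sandwich: a real hook-up through the big blobs is a fuzzy hook-up (stub S11, road map item 0)

`bigRoute`, `THookBig` (= `Hook(η₁)`: hook-up through interior sites and big blobs with real adjacency),
`tHookBig_subset_tHook`, `tPinch_inter_tHookBig_subset_tHookStar`, and the error decomposition
`tPinch_inter_symmDiff_subset : TPinch ∩ (THook ∆ THookStar) ⊆ (THookStar ∖ THook) ∪ (THook ∖ THookBig)`.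
-/

noncomputable section

namespace Summit.CriticalPhenomena.CardyFormulaZ2.Cruxes.NestingRigidity.PinchResampling

open MeasureTheory Set Literature.Probability.Percolation Literature.Probability.LatticeModels
open scoped symmDiff

section HookStar

/-! ### The easy half of the sandwich: a real hook-up through big blobs is a fuzzy hook-up -/

/-- The sites usable by a **hook-up through the big blobs**: open sites of the ball, and open collar sites whose blob is big
(two vertices at `triNorm`-distance `≥ lam`) and touches the inner layer.  (`η₁` of the road map is `η` restricted to these
sites inside `Λ_{2s}(x)`, plus the rest of the collar, which a hook-up path never uses.) -/
def bigRoute (lam s : ℕ) (x : Site 2) (η : SiteConfig (Site 2)) : Set (Site 2) :=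
  {v | v ∈ η ∧ (v ∈ tBall x s ∨
    ((∃ w ∈ blobOf (tColourGraph η true) (tBall x (2 * s) \ tBall x s) v,
        ∃ w' ∈ blobOf (tColourGraph η true) (tBall x (2 * s) \ tBall x s) v, (lam : ℤ) ≤ triNorm (w - w')) ∧
      ∃ w ∈ blobOf (tColourGraph η true) (tBall x (2 * s) \ tBall x s) v,
        w ∈ innerLayer triGraph (tBall x s) (tBall x (2 * s))))}

/-- **`Hook(η₁)`: the hook-up of `Λ_s(x)` through interior sites and BIG blobs only, with real adjacency** — all open
crossings of the collar are joined by a `𝕋`-path of sites of `bigRoute` inside `Λ_{2s}(x)`. -/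
def THookBig (lam s : ℕ) (x : Site 2) : Set (SiteConfig (Site 2)) :=
  {η | ∀ v w, IsCrossing triGraph (tColourGraph η true) (tBall x s) (tBall x (2 * s)) v →
    IsCrossing triGraph (tColourGraph η true) (tBall x s) (tBall x (2 * s)) w →
    PathIn triGraph (bigRoute lam s x η ∩ tBall x (2 * s)) v w}

/-- A hook-up through big blobs is a hook-up. -/
theorem tHookBig_subset_tHook (lam s : ℕ) (x : Site 2) : THookBig lam s x ⊆ THook x x s s := by
  intro η hη v w hv hw
  have hp := hη v w hv hw
  clear hv hw
  rw [tColourGraph_true]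
  obtain ⟨hv0, p⟩ := hp
  refine ⟨hv0.2, ?_⟩
  induction p with
  | refl => exact Relation.ReflTransGen.refl
  | @tail b c hab hbc ih =>
    have hb : b ∈ bigRoute lam s x η ∩ tBall x (2 * s) :=
      PathIn.right_mem (show PathIn triGraph _ v b from ⟨hv0, hab⟩)
    exact ih.tail ⟨(siteOpenGraph_adj triGraph η b c).2 ⟨hbc.1, hb.1.1, hbc.2.1.1⟩, hbc.2.2⟩

section Sandwich

variable {ℓ lam s : ℕ} {x o : Site 2} {η : SiteConfig (Site 2)}

/-- An open collar site `w` on the inner layer, `𝕋`-adjacent to the open interior site `u`, makes `u` a toucher of the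
coarse footprint of the blob of `w`. -/
theorem mem_touchers_of_adj {u w : Site 2} (hu : u ∈ η) (huK : u ∈ tBall x s)
    (hw : w ∈ innerLayer triGraph (tBall x s) (tBall x (2 * s))) (hadj : triGraph.Adj u w) {v : Site 2}
    (hwv : w ∈ blobOf (tColourGraph η true) (tBall x (2 * s) \ tBall x s) v) :
    u ∈ touchers ℓ s x o η
      (cellOf ℓ o '' (blobOf (tColourGraph η true) (tBall x (2 * s) \ tBall x s) v ∩
        innerLayer triGraph (tBall x s) (tBall x (2 * s)))) :=
  ⟨hu, huK, w, hw, hadj, mem_image_of_mem _ ⟨hwv, hw⟩⟩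

/-- The coarse footprint of a big inner-touching blob (given by any of its members `v`) belongs to the coarse datum. -/
theorem footprint_mem_tCoarse {v w₀ : Site 2} (hw₀ : w₀ ∈ blobOf (tColourGraph η true) (tBall x (2 * s) \ tBall x s) v)
    (hw₀L : w₀ ∈ innerLayer triGraph (tBall x s) (tBall x (2 * s)))
    (hbig : ∃ w ∈ blobOf (tColourGraph η true) (tBall x (2 * s) \ tBall x s) v,
      ∃ w' ∈ blobOf (tColourGraph η true) (tBall x (2 * s) \ tBall x s) v, (lam : ℤ) ≤ triNorm (w - w')) :
    cellOf ℓ o '' (blobOf (tColourGraph η true) (tBall x (2 * s) \ tBall x s) v ∩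
        innerLayer triGraph (tBall x s) (tBall x (2 * s))) ∈
      (tCoarse ℓ lam s x o η).1 ∪ (tCoarse ℓ lam s x o η).2 := by
  have hbv : blobOf (tColourGraph η true) (tBall x (2 * s) \ tBall x s) w₀ =
      blobOf (tColourGraph η true) (tBall x (2 * s) \ tBall x s) v := NeckCoarse.blobOf_eq_of_mem hw₀
  by_cases hcross : ∃ w ∈ blobOf (tColourGraph η true) (tBall x (2 * s) \ tBall x s) v,
      w ∈ outerLayer triGraph (tBall x s) (tBall x (2 * s))
  · left
    refine ⟨w₀, hw₀L, ?_, ?_, ?_⟩ <;> rw [hbv]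
    · exact hbig
    · exact hcross
  · right
    push Not at hcross
    refine ⟨w₀, hw₀L, ?_, ?_, ?_⟩ <;> rw [hbv]
    · exact hbig
    · exact hcross

/-- **Chain extraction.**  Along a `𝕋`-path of `bigRoute` sites of `Λ_{2s}(x)` starting at a collar site `v`: either the path
has stayed inside the blob of `v`, or there are a toucher `u` of the coarse footprint of `blob v` and — if the endpoint `z`
is interior — a fuzzy chain from `u` to `z`, resp. — if `z` is in the collar — a toucher `u'` of the footprint of `blob z`
with a fuzzy chain from `u` to `u'`. -/
theorem chain_of_pathIn {v z : Site 2} (hvA : v ∈ tBall x (2 * s) \ tBall x s)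
    (hp : PathIn triGraph (bigRoute lam s x η ∩ tBall x (2 * s)) v z) :
    (z ∈ tBall x s → ∃ u ∈ touchers ℓ s x o η (cellOf ℓ o '' (blobOf (tColourGraph η true) (tBall x (2 * s) \ tBall x s) v ∩
        innerLayer triGraph (tBall x s) (tBall x (2 * s)))),
      Relation.ReflTransGen (fun a b ↦ (a, b) ∈ starPairs ℓ s x o (tCoarse ℓ lam s x o η) η) u z) ∧
    (z ∉ tBall x s → PathIn (tColourGraph η true) (tBall x (2 * s) \ tBall x s) v z ∨
      ∃ u ∈ touchers ℓ s x o η (cellOf ℓ o '' (blobOf (tColourGraph η true) (tBall x (2 * s) \ tBall x s) v ∩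
        innerLayer triGraph (tBall x s) (tBall x (2 * s)))),
      ∃ u' ∈ touchers ℓ s x o η (cellOf ℓ o '' (blobOf (tColourGraph η true) (tBall x (2 * s) \ tBall x s) z ∩
        innerLayer triGraph (tBall x s) (tBall x (2 * s)))),
        Relation.ReflTransGen (fun a b ↦ (a, b) ∈ starPairs ℓ s x o (tCoarse ℓ lam s x o η) η) u u') := by
  set K := tBall x s with hK
  set O := tBall x (2 * s) with hO
  set H := tColourGraph η true with hH
  set rel := fun a b ↦ (a, b) ∈ starPairs ℓ s x o (tCoarse ℓ lam s x o η) η with hrel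
  obtain ⟨hv0, p⟩ := hp
  induction p with
  | refl => exact ⟨fun h ↦ (hvA.2 h).elim, fun _ ↦ Or.inl (PathIn.refl hvA)⟩
  | @tail b c hab hbc ih =>
    obtain ⟨hadj, hcR, hcO⟩ := hbc
    have hbRO : b ∈ bigRoute lam s x η ∩ O := PathIn.right_mem (show PathIn triGraph _ v b from ⟨hv0, hab⟩)
    have hbη : b ∈ η := hbRO.1.1
    have hcη : c ∈ η := hcR.1
    by_cases hbK : b ∈ K
    · obtain ⟨u, hu, huc⟩ := ih.1 hbK
      by_cases hcK : c ∈ K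
      · refine ⟨fun _ ↦ ⟨u, hu, huc.tail (Or.inl ⟨hbη, hbK, hcη, hcK, hadj⟩)⟩, fun h ↦ (h hcK).elim⟩
      · have hcL : c ∈ innerLayer triGraph K O := NeckCoarse.mem_innerLayer_of_adj ⟨hcO, hcK⟩ hbK hadj.symm
        refine ⟨fun h ↦ (hcK h).elim, fun _ ↦ Or.inr ⟨u, hu, b, ?_, huc⟩⟩
        exact mem_touchers_of_adj hbη hbK hcL hadj (NeckCoarse.self_mem_blobOf ⟨hcO, hcK⟩)
    · have hbA : b ∈ O \ K := ⟨hbRO.2, hbK⟩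
      by_cases hcK : c ∈ K
      · have hbL : b ∈ innerLayer triGraph K O := NeckCoarse.mem_innerLayer_of_adj hbA hcK hadj
        refine ⟨fun _ ↦ ?_, fun h ↦ (h hcK).elim⟩
        rcases ih.2 hbK with hvb | ⟨u, hu, u', hu', huu'⟩
        · exact ⟨c, mem_touchers_of_adj hcη hcK hbL hadj.symm hvb, Relation.ReflTransGen.refl⟩
        · refine ⟨u, hu, huu'.tail (Or.inr ⟨_, ?_, hu', ?_⟩)⟩
          · obtain ⟨-, hb2⟩ := hbRO.1
            rcases hb2 with hbK' | ⟨hbig, -⟩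
            · exact (hbK hbK').elim
            · exact footprint_mem_tCoarse (NeckCoarse.self_mem_blobOf hbA) hbL hbig
          · exact mem_touchers_of_adj hcη hcK hbL hadj.symm (NeckCoarse.self_mem_blobOf hbA)
      · have hHbc : H.Adj b c := by
          rw [hH, tColourGraph_true, siteOpenGraph_adj]; exact ⟨hadj, hbη, hcη⟩
        have hcb : blobOf H (O \ K) c = blobOf H (O \ K) b :=
          NeckCoarse.blobOf_eq_of_mem (PathIn.of_adj hbA ⟨hcO, hcK⟩ hHbc)
        refine ⟨fun h ↦ (hcK h).elim, fun _ ↦ ?_⟩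
        rcases ih.2 hbK with hvb | ⟨u, hu, u', hu', huu'⟩
        · exact Or.inl (hvb.tail hHbc ⟨hcO, hcK⟩)
        · refine Or.inr ⟨u, hu, u', ?_, huu'⟩
          rwa [hcb]

/-- **The easy half of the sandwich (road map, item 0): on the selection event, a real hook-up through the big blobs is a
fuzzy hook-up.**  Hence `TPinch ∩ (THook ∆ THookStar) ⊆ (TPinch ∩ THookStar ∖ THook) ∪ (TPinch ∩ THook ∖ THookBig)`. -/
theorem tPinch_inter_tHookBig_subset_tHookStar (ℓ lam s : ℕ) (x o : Site 2) :
    TPinch x x s s ∩ THookBig lam s x ⊆ THookStar ℓ lam s x o := by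
  rintro η ⟨hPinch, hBig⟩
  set K := tBall x s with hK
  set O := tBall x (2 * s) with hO
  set H := tColourGraph η true with hH
  -- witnesses of crossing footprints are crossings
  have hcross : ∀ {v : Site 2}, v ∈ innerLayer triGraph K O →
      (∃ w ∈ blobOf H (O \ K) v, w ∈ outerLayer triGraph K O) → IsCrossing triGraph H K O v :=
    fun hvL ⟨w, hw, hwo⟩ ↦ ⟨hvL, w, hwo, hw⟩
  -- every crossing footprint has a toucher (detour through the other crossing cluster, by `TPinch`)
  have htouch : ∀ {v : Site 2}, v ∈ innerLayer triGraph K O → (∃ w ∈ blobOf H (O \ K) v, w ∈ outerLayer triGraph K O) →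
      ∃ u, u ∈ touchers ℓ s x o η (cellOf ℓ o '' (blobOf H (O \ K) v ∩ innerLayer triGraph K O)) := by
    intro v hvL hvc
    obtain ⟨⟨v₁, v₂, hv₁, hv₂, hne⟩, -⟩ := hPinch.1
    rcases (chain_of_pathIn (ℓ := ℓ) (o := o) hvL.1 (hBig _ _ (hcross hvL hvc) hv₁)).2 hv₁.1.1.2 with h₁ | ⟨u, hu, -⟩
    · rcases (chain_of_pathIn (ℓ := ℓ) (o := o) hvL.1 (hBig _ _ (hcross hvL hvc) hv₂)).2 hv₂.1.1.2 with h₂ | ⟨u, hu, -⟩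
      · exact (hne (h₁.symm.trans h₂)).elim
      · exact ⟨u, hu⟩
    · exact ⟨u, hu⟩
  rintro S ⟨v, hvL, -, hvc, rfl⟩ S' ⟨v', hv'L, -, hv'c, rfl⟩
  rcases (chain_of_pathIn (ℓ := ℓ) (o := o) hvL.1 (hBig _ _ (hcross hvL hvc) (hcross hv'L hv'c))).2 hv'L.1.2 with
    h | ⟨u, hu, u', hu', huu'⟩
  · obtain ⟨u, hu⟩ := htouch hvL hvc
    rw [NeckCoarse.blobOf_eq_of_mem h]
    exact ⟨u, hu, u, hu, Relation.ReflTransGen.refl⟩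
  · exact ⟨u, hu, u', hu', huu'⟩

end Sandwich

/-- **The error decomposition (road map, item 0)**: on the selection event, the symmetric difference of the hook-up and the
fuzzy hook-up is covered by `𝔄 = THookStar ∖ THook` (treated by `covering_A`) and `𝔅 = THook ∖ THookBig` (treated by
`covering_B`). -/
theorem tPinch_inter_symmDiff_subset : ∀ (ℓ lam s : ℕ) (x o : Site 2), TPinch x x s s ∩ symmDiff (THook x x s s) (THookStar ℓ lam s x o) ⊆ (THookStar ℓ lam s x o \ THook x x s s) ∪ (THook x x s s \ THookBig lam s x) := by
  rintro ℓ lam s x o η ⟨hP, hΔ⟩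
  rcases (mem_symmDiff.1 hΔ) with ⟨hH, hnS⟩ | ⟨hS, hnH⟩
  · exact Or.inr ⟨hH, fun hB ↦ hnS (tPinch_inter_tHookBig_subset_tHookStar ℓ lam s x o ⟨hP, hB⟩)⟩
  · exact Or.inl ⟨hS, hnH⟩

end HookStar

end Summit.CriticalPhenomena.CardyFormulaZ2.Cruxes.NestingRigidity.PinchResampling

end
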